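import Summits.HubbardSuperconductivity.HubbardSuperconductivity.Theorems.AnisotropyChordTransferFibre3S2Bracket

/-!
# Route `AnisotropyChord` / H0 rotor rung, LEVEL 2 family B1: pointwise tools for the GENERIC L-UNIFORM BRACKET of
near-dominated lattice sums (finite products of shifted propagator powers)

Memo ROTOR-THEORY-21 §311(b) (theory seat `hubbard-h0-rotor-theory-1` g21): every family-B1 input of the Level-2
certificate (`S_p`, `Σ_k g(k)^a g(k+K₁)^b`, the convolutions `t(q)`, `Π̂`-type triangles, …) is a torus sum
`Σ_{k ∈ (ℤ/L)²} Π_i g(k + s_i)^{a_i}` of total degree `n = Σ a_i ≥ 2` in the propagator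
`g(k) = 1/(2ε(k) − λ)` (`k ≠ 0`, `λ = νθ²`, `θ = 2π/L`), and «the same brackets applied factorwise handle every B1 sum
(shifted factors bracketed at m + m_ext)».  This file proves the PER-FACTOR inequalities behind that sentence, in the
first power (PartN35 / `…Fibre3S2Pointwise` has the squared, single-factor versions used for `S₂`):
with `X = θ²/(E − νθ²)`, `E = 2(1 − cos θx) + 2(1 − cos θy)` the scaled propagator at the integer lift `(x, y)`,

* `factor_den_pos`, `factor_lower` : `0 < E − νθ²` and `1/(x² + y² − ν) ≤ X` (`2(1 − cos u) ≤ u²`, Jordan for positivity);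
* `window_den_pos`, `factor_window` : `X ≤ 1/(W_{θ₀}(x,y) − ν)`, `W_{θ₀}(x,y) = x²(1 − θ₀²x²/12) + y²(1 − θ₀²y²/12)`, on the
  window `x², y² ≤ K²`, `θ ≤ θ₀`, `θ₀K ≤ π/2` (`u² − u⁴/12 ≤ 2(1 − cos u)`);
* `factor_tail` : `X ≤ (π²/4)/(S − νπ²/4)` from Jordan `(4/π²)θ²S ≤ E`; `pow_le_pow_mul_sq` : `Xⁿ ≤ B^{n−2}·J²`;
* `prod_pow_le_sum_pow` : the weighted AM–GM step `Π_i X_i^{a_i} ≤ Σ_i (a_i/n) X_iⁿ` (`n = Σ a_i`), which sends every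
  factor of a tail term to the SAME one-propagator tail after reindexing `k ↦ k + s_i`;
* `natAbs_valMinAbs_intCast_gt` : the WRAP LEMMA — an integer `x` with `K' < |x| ≤ L/2 + S`, `L/2 + S + K' < L`, has centred
  residue mod `L` of modulus `> K'` (so a shifted tail momentum stays in the tail of its own centred representative);
* torus bookkeeping: `two_epsT_add_intCast`, `two_epsT_intCast` (dispersion at a shifted point through an integer lift),
  `gres_nonneg`, `rep_injective`, `rep_mem_zWindow`, `intCast_eq_of_mem_box`, `intCast_ne_zero_of_mem_zWindow`, `mem_zWindow_iff`.

The bracket theorem itself (defs of the window sums + `b1Bracket`) is the sibling module `…Fibre3B1Bracket`.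
Prover seat `hubbard-h0-rotor-p2` g4; helper for piece A = stmt-HubbardSuperconductivity-23918 of rung 19089
(`--supports`, helper class).  Nothing here proves superconductivity in the Hubbard model; these are helper lemmas of ONE
conditional reduction (the GM₃ ∀L certificate); the rotor TARGET as originally worded stays FALSE (g15 verdict).
Mathlib + the tree only; no sorry.
-/

set_option linter.dupNamespace false
set_option autoImplicit false

noncomputable section

open scoped BigOperators

namespace Summit.HubbardSuperconductivity.HubbardSuperconductivity.Theorems.AnisotropyChord.Transfer.Fibre3.B1

variable (L : ℕ) [NeZero L]

/-! ## Per-factor real inequalities (`X = θ²/(E − νθ²)`, `E = 2(1 − cos θx) + 2(1 − cos θy)`) -/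

/-- positivity of a propagator denominator off the origin: `0 < E − νθ²` (Jordan, `x² + y² ≥ 1`, `ν < 4/π²`). [folklore] -/
theorem factor_den_pos (θ ν x y : ℝ) (hθ : 0 < θ) (hν : ν < 4 / Real.pi ^ 2) (hS : 1 ≤ x ^ 2 + y ^ 2)
    (hx : |θ * x| ≤ Real.pi) (hy : |θ * y| ≤ Real.pi) :
    0 < (2 * (1 - Real.cos (θ * x)) + 2 * (1 - Real.cos (θ * y))) - ν * θ ^ 2 := by
  have lo1 := jordan_sq_le (θ * x) hx
  have lo2 := jordan_sq_le (θ * y) hy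
  have hθ2 := pow_pos hθ 2
  have h1 : 4 / Real.pi ^ 2 * θ ^ 2 * 1 ≤ 4 / Real.pi ^ 2 * θ ^ 2 * (x ^ 2 + y ^ 2) :=
    mul_le_mul_of_nonneg_left hS (by positivity)
  have h2 : ν * θ ^ 2 < 4 / Real.pi ^ 2 * θ ^ 2 := mul_lt_mul_of_pos_right hν hθ2
  have e : 4 / Real.pi ^ 2 * (θ * x) ^ 2 + 4 / Real.pi ^ 2 * (θ * y) ^ 2
      = 4 / Real.pi ^ 2 * θ ^ 2 * (x ^ 2 + y ^ 2) := by ring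
  linarith

/-- LOWER per factor: `1/(x² + y² − ν) ≤ θ²/(E − νθ²)` (from `2(1 − cos u) ≤ u²`). [folklore] -/
theorem factor_lower (θ ν x y : ℝ) (hθ : 0 < θ) (hν : ν < 4 / Real.pi ^ 2) (hS : 1 ≤ x ^ 2 + y ^ 2)
    (hx : |θ * x| ≤ Real.pi) (hy : |θ * y| ≤ Real.pi) :
    1 / ((x ^ 2 + y ^ 2) - ν)
      ≤ θ ^ 2 / ((2 * (1 - Real.cos (θ * x)) + 2 * (1 - Real.cos (θ * y))) - ν * θ ^ 2) := by
  have hD := factor_den_pos θ ν x y hθ hν hS hx hy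
  have up1 := two_mul_one_sub_cos_le_sq (θ * x)
  have up2 := two_mul_one_sub_cos_le_sq (θ * y)
  have hθ2 := pow_pos hθ 2
  have hle : (2 * (1 - Real.cos (θ * x)) + 2 * (1 - Real.cos (θ * y))) - ν * θ ^ 2
      ≤ θ ^ 2 * ((x ^ 2 + y ^ 2) - ν) := by nlinarith
  have hc : 0 < (x ^ 2 + y ^ 2) - ν := by
    by_contra h
    push Not at h
    nlinarith
  rw [div_le_div_iff₀ hc hD]
  linarith

/-- positivity of the Taylor window denominator: `0 < W_{θ₀}(x,y) − ν` on `x², y² ≤ K²`, `θ₀K ≤ π/2`. [folklore] -/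
theorem window_den_pos (θ0 ν x y Kr : ℝ) (hθ0 : 0 < θ0) (hKr : 0 ≤ Kr) (hθ0K : θ0 * Kr ≤ Real.pi / 2)
    (hν : ν < 4 / Real.pi ^ 2) (hS : 1 ≤ x ^ 2 + y ^ 2) (hx2 : x ^ 2 ≤ Kr ^ 2) (hy2 : y ^ 2 ≤ Kr ^ 2) :
    0 < (x ^ 2 * (1 - θ0 ^ 2 * x ^ 2 / 12) + y ^ 2 * (1 - θ0 ^ 2 * y ^ 2 / 12)) - ν := by
  have hpi3 := Real.pi_gt_three
  have hpi4 := Real.pi_lt_d2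
  have hθ0K2 : θ0 ^ 2 * Kr ^ 2 ≤ Real.pi ^ 2 / 4 := by
    have h0 : 0 ≤ θ0 * Kr := mul_nonneg hθ0.le hKr
    have h1 : (θ0 * Kr) ^ 2 ≤ (Real.pi / 2) ^ 2 := pow_le_pow_left₀ h0 hθ0K 2
    nlinarith
  have f1 : θ0 ^ 2 * x ^ 2 ≤ Real.pi ^ 2 / 4 := le_trans (mul_le_mul_of_nonneg_left hx2 (sq_nonneg _)) hθ0K2
  have f2 : θ0 ^ 2 * y ^ 2 ≤ Real.pi ^ 2 / 4 := le_trans (mul_le_mul_of_nonneg_left hy2 (sq_nonneg _)) hθ0K2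
  have g1 : (1 - Real.pi ^ 2 / 48) * x ^ 2 ≤ x ^ 2 * (1 - θ0 ^ 2 * x ^ 2 / 12) := by
    have h := mul_nonneg (sq_nonneg x) (sub_nonneg.2 f1)
    nlinarith [h]
  have g2 : (1 - Real.pi ^ 2 / 48) * y ^ 2 ≤ y ^ 2 * (1 - θ0 ^ 2 * y ^ 2 / 12) := by
    have h := mul_nonneg (sq_nonneg y) (sub_nonneg.2 f2)
    nlinarith [h]
  have g3 : ν < 4 / 9 := by
    calc ν < 4 / Real.pi ^ 2 := hν
      _ ≤ 4 / 9 := by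
        apply div_le_div_of_nonneg_left (by norm_num) (by norm_num)
        nlinarith
  have gπ : Real.pi ^ 2 < 10 := by nlinarith
  have g5 : (1 - Real.pi ^ 2 / 48) * 1 ≤ (1 - Real.pi ^ 2 / 48) * (x ^ 2 + y ^ 2) :=
    mul_le_mul_of_nonneg_left hS (by linarith)
  linarith

/-- an angle of modulus at most `π`, from `x² ≤ K²`, `θ ≤ θ₀`, `θ₀K ≤ π/2`. [folklore] -/
theorem abs_angle_le_pi_of_sq_le (θ θ0 x Kr : ℝ) (hθ : 0 < θ) (hθle : θ ≤ θ0) (hKr : 0 ≤ Kr)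
    (hθ0K : θ0 * Kr ≤ Real.pi / 2) (hx2 : x ^ 2 ≤ Kr ^ 2) : |θ * x| ≤ Real.pi := by
  have hxa : |x| ≤ Kr := abs_le_of_sq_le_sq (by simpa using hx2) hKr
  rw [abs_mul, abs_of_pos hθ]
  have : θ * |x| ≤ θ0 * Kr := mul_le_mul hθle hxa (abs_nonneg x) (hθ.le.trans hθle)
  linarith [Real.pi_pos]

/-- WINDOW per factor: `θ²/(E − νθ²) ≤ 1/(W_{θ₀}(x,y) − ν)` from `u² − u⁴/12 ≤ 2(1 − cos u)` and `θ ≤ θ₀`. [folklore] -/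
theorem factor_window (θ θ0 ν x y Kr : ℝ) (hθ : 0 < θ) (hθle : θ ≤ θ0) (hKr : 0 ≤ Kr)
    (hθ0K : θ0 * Kr ≤ Real.pi / 2) (hν : ν < 4 / Real.pi ^ 2) (hS : 1 ≤ x ^ 2 + y ^ 2)
    (hx2 : x ^ 2 ≤ Kr ^ 2) (hy2 : y ^ 2 ≤ Kr ^ 2) :
    θ ^ 2 / ((2 * (1 - Real.cos (θ * x)) + 2 * (1 - Real.cos (θ * y))) - ν * θ ^ 2)
      ≤ 1 / ((x ^ 2 * (1 - θ0 ^ 2 * x ^ 2 / 12) + y ^ 2 * (1 - θ0 ^ 2 * y ^ 2 / 12)) - ν) := by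
  have hθ0 : 0 < θ0 := lt_of_lt_of_le hθ hθle
  have hW := window_den_pos θ0 ν x y Kr hθ0 hKr hθ0K hν hS hx2 hy2
  have hx := abs_angle_le_pi_of_sq_le θ θ0 x Kr hθ hθle hKr hθ0K hx2
  have hy := abs_angle_le_pi_of_sq_le θ θ0 y Kr hθ hθle hKr hθ0K hy2
  have t1 := sq_sub_quartic_le (θ * x) hx
  have t2 := sq_sub_quartic_le (θ * y) hy
  have hθ2 : θ ^ 2 ≤ θ0 ^ 2 := pow_le_pow_left₀ hθ.le hθle 2
  have q1 : θ ^ 2 * (x ^ 2 * (1 - θ0 ^ 2 * x ^ 2 / 12)) ≤ (θ * x) ^ 2 - (θ * x) ^ 4 / 12 := by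
    have h := mul_nonneg (mul_nonneg (sq_nonneg θ) (sq_nonneg (x ^ 2))) (sub_nonneg.2 hθ2)
    nlinarith [h]
  have q2 : θ ^ 2 * (y ^ 2 * (1 - θ0 ^ 2 * y ^ 2 / 12)) ≤ (θ * y) ^ 2 - (θ * y) ^ 4 / 12 := by
    have h := mul_nonneg (mul_nonneg (sq_nonneg θ) (sq_nonneg (y ^ 2))) (sub_nonneg.2 hθ2)
    nlinarith [h]
  have hD := factor_den_pos θ ν x y hθ hν hS hx hy
  rw [div_le_div_iff₀ hD hW]
  have e : θ ^ 2 * ((x ^ 2 * (1 - θ0 ^ 2 * x ^ 2 / 12) + y ^ 2 * (1 - θ0 ^ 2 * y ^ 2 / 12)) - ν)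
      = θ ^ 2 * (x ^ 2 * (1 - θ0 ^ 2 * x ^ 2 / 12)) + θ ^ 2 * (y ^ 2 * (1 - θ0 ^ 2 * y ^ 2 / 12))
        - ν * θ ^ 2 := by ring
  rw [e]
  linarith

/-- TAIL per factor: Jordan `(4/π²)θ²S ≤ E` gives `θ²/(E − νθ²) ≤ (π²/4)/(S − νπ²/4)` (`S > νπ²/4`). [folklore] -/
theorem factor_tail (θ ν S E : ℝ) (hθ : 0 < θ) (hS : ν * Real.pi ^ 2 / 4 < S)
    (hjordan : 4 / Real.pi ^ 2 * θ ^ 2 * S ≤ E) :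
    θ ^ 2 / (E - ν * θ ^ 2) ≤ Real.pi ^ 2 / 4 / (S - ν * Real.pi ^ 2 / 4) := by
  have hpi := Real.pi_pos
  have hc : 0 < S - ν * Real.pi ^ 2 / 4 := by linarith
  have hid : 4 / Real.pi ^ 2 * θ ^ 2 * (ν * Real.pi ^ 2 / 4) = ν * θ ^ 2 := by field_simp
  have hle : (4 / Real.pi ^ 2 * θ ^ 2) * (S - ν * Real.pi ^ 2 / 4) ≤ E - ν * θ ^ 2 := by nlinarith
  have hpos : 0 < (4 / Real.pi ^ 2 * θ ^ 2) * (S - ν * Real.pi ^ 2 / 4) := by positivity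
  have hD : 0 < E - ν * θ ^ 2 := lt_of_lt_of_le hpos hle
  rw [div_le_div_iff₀ hD hc]
  calc θ ^ 2 * (S - ν * Real.pi ^ 2 / 4)
      = Real.pi ^ 2 / 4 * ((4 / Real.pi ^ 2 * θ ^ 2) * (S - ν * Real.pi ^ 2 / 4)) := by
        field_simp
    _ ≤ Real.pi ^ 2 / 4 * (E - ν * θ ^ 2) := mul_le_mul_of_nonneg_left hle (by positivity)

/-- powers in the tail: `0 ≤ X ≤ J ≤ B` and `n ≥ 2` give `Xⁿ ≤ B^{n−2}·J²`. [folklore] -/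
theorem pow_le_pow_mul_sq (X J B : ℝ) (n : ℕ) (hn : 2 ≤ n) (hX0 : 0 ≤ X) (hXJ : X ≤ J) (hJB : J ≤ B) :
    X ^ n ≤ B ^ (n - 2) * J ^ 2 := by
  obtain ⟨m, rfl⟩ : ∃ m, n = m + 2 := ⟨n - 2, by omega⟩
  rw [Nat.add_sub_cancel, pow_add]
  have hJ0 : 0 ≤ J := hX0.trans hXJ
  exact mul_le_mul (pow_le_pow_left₀ hX0 (hXJ.trans hJB) m) (pow_le_pow_left₀ hX0 hXJ 2)
    (by positivity) (pow_nonneg (hJ0.trans hJB) m)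

/-! ## The weighted AM–GM step for natural powers -/

/-- `Π_i X_i^{a_i} ≤ Σ_i (a_i/n)·X_iⁿ` for `X_i ≥ 0`, `n = Σ_i a_i ≠ 0` (weighted AM–GM with weights `a_i/n`). [folklore] -/
theorem prod_pow_le_sum_pow {ι : Type*} (s : Finset ι) (X : ι → ℝ) (hX : ∀ i ∈ s, 0 ≤ X i)
    (a : ι → ℕ) (n : ℕ) (hn : ∑ i ∈ s, a i = n) (hn0 : n ≠ 0) :
    ∏ i ∈ s, X i ^ a i ≤ ∑ i ∈ s, ((a i : ℝ) / n) * X i ^ n := by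
  have hnR : (n : ℝ) ≠ 0 := by exact_mod_cast hn0
  have hw1 : ∑ i ∈ s, ((a i : ℝ) / n) = 1 := by
    rw [← Finset.sum_div, ← Nat.cast_sum, hn, div_self hnR]
  have key := Real.geom_mean_le_arith_mean_weighted s (fun i => (a i : ℝ) / n) (fun i => X i ^ n)
    (fun i _ => by positivity) hw1 (fun i hi => pow_nonneg (hX i hi) n)
  have e : ∀ i ∈ s, (X i ^ n) ^ ((a i : ℝ) / n) = X i ^ a i := by
    intro i hi
    rw [← Real.rpow_natCast (X i) n, ← Real.rpow_mul (hX i hi),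
      show (n : ℝ) * ((a i : ℝ) / n) = (a i : ℝ) by field_simp, Real.rpow_natCast]
  rw [Finset.prod_congr rfl e] at key
  exact key

/-! ## The wrap lemma (centred residues of shifted momenta) -/

/-- WRAP LEMMA: if `K' < |x| ≤ L/2 + S` and `L/2 + S + K' < L`, the centred residue of `x` mod `L` has modulus `> K'`.
[folklore] -/
theorem natAbs_valMinAbs_intCast_gt (x : ℤ) (K' S : ℕ) (hx : x.natAbs ≤ L / 2 + S) (hK : K' < x.natAbs)
    (hL : L / 2 + S + K' < L) : K' < (((x : ZMod L)).valMinAbs).natAbs := by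
  set y : ℤ := ((x : ZMod L)).valMinAbs with hy
  have hyL : y.natAbs ≤ L / 2 := ZMod.natAbs_valMinAbs_le _
  have hdvd : (L : ℤ) ∣ y - x := by
    rw [← ZMod.intCast_eq_intCast_iff_dvd_sub, hy, ZMod.coe_valMinAbs]
  have hx' : |x| ≤ ((L / 2 : ℕ) : ℤ) + S := by
    rw [← Int.natCast_natAbs]; exact_mod_cast hx
  have hK2 : (K' : ℤ) < |x| := by
    rw [← Int.natCast_natAbs]; exact_mod_cast hK
  have hy' : |y| ≤ ((L / 2 : ℕ) : ℤ) := by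
    rw [← Int.natCast_natAbs]; exact_mod_cast hyL
  have hL' : ((L / 2 : ℕ) : ℤ) + S + K' < L := by exact_mod_cast hL
  suffices h : (K' : ℤ) < |y| by
    rw [← Int.natCast_natAbs] at h
    exact_mod_cast h
  by_cases h0 : y - x = 0
  · have : y = x := by linarith
    rw [this]
    exact hK2
  · have hge : (L : ℤ) ≤ |y - x| := by
      by_contra hlt
      push Not at hlt
      exact h0 (Int.eq_zero_of_abs_lt_dvd hdvd hlt)
    have htri : |y - x| ≤ |y| + |x| := abs_sub y x
    linarith

/-! ## Torus bookkeeping -/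

/-- membership in the punctured window. [folklore] -/
theorem mem_zWindow_iff (M : ℕ) (p : ℤ × ℤ) :
    p ∈ zWindow M ↔ p ≠ (0, 0) ∧ (-(M : ℤ) ≤ p.1 ∧ p.1 ≤ M) ∧ (-(M : ℤ) ≤ p.2 ∧ p.2 ≤ M) := by
  unfold zWindow
  simp only [Finset.mem_erase, Finset.mem_product, Finset.mem_Icc, ne_eq]

/-- the dispersion at a momentum shifted by an integer vector, through the integer lift `rep(k) + s`:
`2ε(k + s) = 2(1 − cos θ(m + s₁)) + 2(1 − cos θ(n + s₂))`, `(m, n)` the centred representative of `k`, `θ = 2π/L`. [folklore] -/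
theorem two_epsT_add_intCast (k : Tor L) (s : ℤ × ℤ) :
    2 * epsT L (k + ((((s.1 : ℤ)) : ZMod L), (((s.2 : ℤ)) : ZMod L)))
      = 2 * (1 - Real.cos (2 * Real.pi / L * (((k.1.valMinAbs + s.1 : ℤ)) : ℝ)))
        + 2 * (1 - Real.cos (2 * Real.pi / L * (((k.2.valMinAbs + s.2 : ℤ)) : ℝ))) := by
  have e1 : (k + ((((s.1 : ℤ)) : ZMod L), (((s.2 : ℤ)) : ZMod L))).1 = (((k.1.valMinAbs + s.1 : ℤ)) : ZMod L) := by
    simp [ZMod.coe_valMinAbs]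
  have e2 : (k + ((((s.1 : ℤ)) : ZMod L), (((s.2 : ℤ)) : ZMod L))).2 = (((k.2.valMinAbs + s.2 : ℤ)) : ZMod L) := by
    simp [ZMod.coe_valMinAbs]
  have c1 := cos_two_pi_val_intCast L (k.1.valMinAbs + s.1)
  have c2 := cos_two_pi_val_intCast L (k.2.valMinAbs + s.2)
  unfold epsT
  rw [e1, e2, c1, c2]
  have a1 : 2 * Real.pi * (((k.1.valMinAbs + s.1 : ℤ)) : ℝ) / L
      = 2 * Real.pi / L * (((k.1.valMinAbs + s.1 : ℤ)) : ℝ) := by ring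
  have a2 : 2 * Real.pi * (((k.2.valMinAbs + s.2 : ℤ)) : ℝ) / L
      = 2 * Real.pi / L * (((k.2.valMinAbs + s.2 : ℤ)) : ℝ) := by ring
  rw [a1, a2]
  ring

/-- the dispersion at an integer vector read on the torus: `2ε(p) = 2(1 − cos θp₁) + 2(1 − cos θp₂)`. [folklore] -/
theorem two_epsT_intCast (p : ℤ × ℤ) :
    2 * epsT L ((((p.1 : ℤ)) : ZMod L), (((p.2 : ℤ)) : ZMod L))
      = 2 * (1 - Real.cos (2 * Real.pi / L * ((p.1 : ℤ) : ℝ)))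
        + 2 * (1 - Real.cos (2 * Real.pi / L * ((p.2 : ℤ) : ℝ))) := by
  have c1 := cos_two_pi_val_intCast L p.1
  have c2 := cos_two_pi_val_intCast L p.2
  unfold epsT
  rw [show ((((p.1 : ℤ)) : ZMod L), (((p.2 : ℤ)) : ZMod L)).1 = (((p.1 : ℤ)) : ZMod L) from rfl,
    show ((((p.1 : ℤ)) : ZMod L), (((p.2 : ℤ)) : ZMod L)).2 = (((p.2 : ℤ)) : ZMod L) from rfl, c1, c2]
  have a1 : 2 * Real.pi * ((p.1 : ℤ) : ℝ) / L = 2 * Real.pi / L * ((p.1 : ℤ) : ℝ) := by ring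
  have a2 : 2 * Real.pi * ((p.2 : ℤ) : ℝ) / L = 2 * Real.pi / L * ((p.2 : ℤ) : ℝ) := by ring
  rw [a1, a2]
  ring

omit [NeZero L] in
/-- the centred representative is off the origin iff the momentum is. [folklore] -/
theorem rep_ne_zero {k : Tor L} (hk : k ≠ 0) : ((k.1.valMinAbs : ℤ), (k.2.valMinAbs : ℤ)) ≠ (0, 0) := by
  intro h
  apply hk
  exact Prod.ext ((ZMod.valMinAbs_eq_zero _).mp (congrArg Prod.fst h))
    ((ZMod.valMinAbs_eq_zero _).mp (congrArg Prod.snd h))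

omit [NeZero L] in
/-- `k ↦ (valMinAbs k₁, valMinAbs k₂)` is injective. [folklore] -/
theorem rep_injective : Function.Injective (fun k : Tor L => ((k.1.valMinAbs : ℤ), (k.2.valMinAbs : ℤ))) := by
  intro k k' h
  have e1 : k.1.valMinAbs = k'.1.valMinAbs := congrArg Prod.fst h
  have e2 : k.2.valMinAbs = k'.2.valMinAbs := congrArg Prod.snd h
  exact Prod.ext (ZMod.valMinAbs_inj.mp e1) (ZMod.valMinAbs_inj.mp e2)

/-- the centred representative of `k ≠ 0` lies in the punctured window of half-width `L/2`. [folklore] -/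
theorem rep_mem_zWindow {k : Tor L} (hk : k ≠ 0) :
    ((k.1.valMinAbs : ℤ), (k.2.valMinAbs : ℤ)) ∈ zWindow (L / 2) := by
  have hm : k.1.valMinAbs.natAbs ≤ L / 2 := ZMod.natAbs_valMinAbs_le k.1
  have hn : k.2.valMinAbs.natAbs ≤ L / 2 := ZMod.natAbs_valMinAbs_le k.2
  rw [mem_zWindow_iff]
  refine ⟨rep_ne_zero L hk, ⟨?_, ?_⟩, ⟨?_, ?_⟩⟩ <;> omega

omit [NeZero L] in
/-- reading back the centred representative: `((valMinAbs k₁ : ZMod L), (valMinAbs k₂ : ZMod L)) = k`. [folklore] -/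
theorem intCast_rep (k : Tor L) :
    ((((k.1.valMinAbs : ℤ)) : ZMod L), (((k.2.valMinAbs : ℤ)) : ZMod L)) = k := by
  ext <;> simp [ZMod.coe_valMinAbs]

/-- the propagator is nonnegative for `λ = νθ²`, `ν < 4/π²` (Jordan). [folklore] -/
theorem gres_nonneg (ν : ℝ) (hν : ν < 4 / Real.pi ^ 2) (k : Tor L) :
    0 ≤ gres L (ν * (2 * Real.pi / L) ^ 2) k := by
  unfold gres
  split_ifs with hk
  · exact le_rfl
  · apply div_nonneg zero_le_one
    have hj := RateLemma.jordanEpsLower_holds L k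
    have hs := one_le_sq_add_sq _ _ (rep_ne_zero L hk)
    have hLpos : (0 : ℝ) < L := by exact_mod_cast Nat.pos_of_ne_zero (NeZero.ne L)
    have hθ2 : 0 < (2 * Real.pi / L) ^ 2 := by positivity
    have h1 : 2 / Real.pi ^ 2 * (2 * Real.pi / L) ^ 2 * 1
        ≤ 2 / Real.pi ^ 2 * (2 * Real.pi / L) ^ 2
          * ((((k.1.valMinAbs : ℤ) : ℝ)) ^ 2 + (((k.2.valMinAbs : ℤ) : ℝ)) ^ 2) :=
      mul_le_mul_of_nonneg_left hs (by positivity)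
    have h2 : ν * (2 * Real.pi / L) ^ 2 < 4 / Real.pi ^ 2 * (2 * Real.pi / L) ^ 2 :=
      mul_lt_mul_of_pos_right hν hθ2
    have h3 : 2 / Real.pi ^ 2 * (2 * Real.pi / L) ^ 2 * 1 ≤ epsT L k := h1.trans hj
    have h4 : 4 / Real.pi ^ 2 * (2 * Real.pi / L) ^ 2 = 2 * (2 / Real.pi ^ 2 * (2 * Real.pi / L) ^ 2 * 1) := by
      ring
    linarith [h2, h3, h4]

omit [NeZero L] in
/-- two integer vectors of a box of half-width `M`, `2M < L`, with the same image on the torus are equal. [folklore] -/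
theorem intCast_eq_of_mem_box (M : ℕ) (hM : 2 * M < L) (p q : ℤ × ℤ)
    (hp : (-(M : ℤ) ≤ p.1 ∧ p.1 ≤ M) ∧ (-(M : ℤ) ≤ p.2 ∧ p.2 ≤ M))
    (hq : (-(M : ℤ) ≤ q.1 ∧ q.1 ≤ M) ∧ (-(M : ℤ) ≤ q.2 ∧ q.2 ≤ M))
    (h : (((((p.1 : ℤ)) : ZMod L), (((p.2 : ℤ)) : ZMod L)) : Tor L)
      = ((((q.1 : ℤ)) : ZMod L), (((q.2 : ℤ)) : ZMod L))) : p = q := by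
  have e1 : (((p.1 : ℤ)) : ZMod L) = (((q.1 : ℤ)) : ZMod L) := congrArg Prod.fst h
  have e2 : (((p.2 : ℤ)) : ZMod L) = (((q.2 : ℤ)) : ZMod L) := congrArg Prod.snd h
  rw [ZMod.intCast_eq_intCast_iff_dvd_sub] at e1 e2
  have hM' : (2 * M : ℕ) < (L : ℤ) := by exact_mod_cast hM
  push_cast at hM'
  have d1 := Int.eq_zero_of_abs_lt_dvd e1 (by rw [abs_lt]; omega)
  have d2 := Int.eq_zero_of_abs_lt_dvd e2 (by rw [abs_lt]; omega)
  exact Prod.ext (by omega) (by omega)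

omit [NeZero L] in
/-- a point of the punctured window `zWindow K`, `K < L`, is nonzero on the torus. [folklore] -/
theorem intCast_ne_zero_of_mem_zWindow (K : ℕ) (hK : K < L) (p : ℤ × ℤ) (hp : p ∈ zWindow K) :
    (((((p.1 : ℤ)) : ZMod L), (((p.2 : ℤ)) : ZMod L)) : Tor L) ≠ 0 := by
  rw [mem_zWindow_iff] at hp
  obtain ⟨hp0, ⟨h1a, h1b⟩, ⟨h2a, h2b⟩⟩ := hp
  intro h0
  have z1 : (((p.1 : ℤ)) : ZMod L) = 0 := congrArg Prod.fst h0
  have z2 : (((p.2 : ℤ)) : ZMod L) = 0 := congrArg Prod.snd h0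
  rw [ZMod.intCast_zmod_eq_zero_iff_dvd] at z1 z2
  have hK' : (K : ℤ) < L := by exact_mod_cast hK
  have d1 := Int.eq_zero_of_abs_lt_dvd z1 (by rw [abs_lt]; omega)
  have d2 := Int.eq_zero_of_abs_lt_dvd z2 (by rw [abs_lt]; omega)
  exact hp0 (Prod.ext d1 d2)

end Summit.HubbardSuperconductivity.HubbardSuperconductivity.Theorems.AnisotropyChord.Transfer.Fibre3.B1

end
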